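import Summits.QuantumFields.QCD.Theorems.SpectralDefectExtinctionWindowExtinctionSpreadR3Atom
import Summits.QuantumFields.QCD.Theorems.SpectralDefectExtinctionWindowExtinctionSpreadR3Arith
import Summits.QuantumFields.QCD.Theorems.SpectralDefectExtinctionWindowExtinctionSpreadTorusBoxes

/-!
# The end-game at one window: constants, centres, and the atom bound on a large torus

Helper for stub `stub_spreadFromPartsR3` (S6′, reshape r3) of line `free-volume-heavy-witness`
(crux `Summit.QuantumFields.QCD.Theses.SpectralDefectExtinction.WindowExtinction`,
item stmt-QuantumFields-8964).  Tree vocabulary only.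

`spreadR3_window`: fix `N_f`, a radius `R`, two measurable template classes `Tp`, `Tm` of positive Haar
measure, `β ≥ 0`, a window `0 < lo ≤ hi`, the one-box cost constants `(A, B)` (stub S2, instance taken
as hypothesis) and the quasi-locality constants `(C₃, κ)` (stub S3, instance taken as hypothesis).  Then
for every `L₀` there is a torus half-side `L' ≥ L₀` with `2R+1 < 2L'+1` such that for all masses in the
window and every measurable integer statistic `X` on the torus `2L'+1` that increases by at least one
under every `Tm → Tp` swap of the content of one box (any centre, any environment), every atom of `X` has
phase-quenched probability `≤ 1/4` — GIVEN the fibre anti-concentration theorem (S4″), the abundance of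
active cores (S5a) and the weighted antichain bound (S4′), all three as hypotheses in literal form.

Route (the docstring of `SpreadFromPartsR3`): odds floor `ε₀ = e^{-2(βA+B)} min(Haar Tp, Haar Tm)`,
`C = C(ε₀)`, `m` with `2C/√(m+1) ≤ 1/8`, activity floor `p = Haar(Tp ∪ Tm) e^{-2(βA+B)}`, `N ≥ m` with
`C(N,N-m+1)(1-p)^{N-m+1} ≤ 1/8`, `D ≥ 1` with `N²|C₃|e^{-κD} ≤ (log 2)/2`, centres `c_i = (i(2R+1+D),0,0,0)`
on the torus of side `2L'+1 ≥ N(2R+1+D)`; then `spreadR3_atom_le_quarter`.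
-/

noncomputable section

namespace Summit.QuantumFields.QCD.Cruxes.WindowExtinction.FreeVolumeHeavyWitness

open MeasureTheory Set Function
open Literature.MathematicalPhysics.QuantumLattice Literature.MathematicalPhysics.QuantumFieldTheory
  Literature.Probability.LatticeModels
open scoped ENNReal BigOperators Classical

/-- **Prescribing the content of a box.** For `2R+1 ≤ n` every template is the content of the box about
`c` of some gauge field on the torus of side `n`. -/
theorem spreadR3_exists_config_with_content :
    ∀ {n R : ℕ}, 2 * R + 1 ≤ n → ∀ (c : Fin 4 → ℤ) (t : (↥(box 4 R) × Fin 4) → SU3),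
      ∃ U : GaugeConfig 4 n SU3,
        (fun yi : ↥(box 4 R) × Fin 4 => U (Torus.proj n (c + (yi.1 : Fin 4 → ℤ)), yi.2)) = t := by
  intro n R hRn c t
  refine ⟨fun e => if h : ∃ y : ↥(box 4 R), Torus.proj n (c + (y : Fin 4 → ℤ)) = e.1
    then t (h.choose, e.2) else 1, ?_⟩
  funext yi
  have h : ∃ y : ↥(box 4 R), Torus.proj n (c + (y : Fin 4 → ℤ)) =
      (Torus.proj n (c + (yi.1 : Fin 4 → ℤ)), yi.2).1 := ⟨yi.1, rfl⟩
  simp only [dif_pos h]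
  have hy : h.choose = yi.1 :=
    Subtype.ext (spread_proj_add_injective hRn c h.choose.2 yi.1.2 h.choose_spec)
  rw [hy]

/-- **The end-game at one window** (see the module docstring). -/
theorem spreadR3_window :
    (∀ {I T : Type} [Fintype I] [DecidableEq I] [MeasurableSpace T]
      (ν : Measure T) [IsProbabilityMeasure ν] {Tp Tm : Set T},
      MeasurableSet Tp → MeasurableSet Tm → Disjoint Tp Tm → ν Tp ≠ 0 →
      ∀ {ε C : ℝ},
      (∀ (N : ℕ) (p : Fin N → ℝ), (∀ i, ε ≤ p i ∧ p i ≤ 1 - ε) →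
        ∀ 𝒜 : Finset (Fin N → Bool), (∀ s ∈ 𝒜, ∀ s' ∈ 𝒜, (∀ i, s i ≤ s' i) → s = s') →
          ∑ s ∈ 𝒜, ∏ i, (if s i then p i else 1 - p i) ≤ C / Real.sqrt (N + 1)) →
      ∀ {φ : (I → T) → ℝ}, Measurable φ → ∀ {a τ B : ℝ} {b : I → T → ℝ},
      (∀ i, Measurable (b i)) →
      (∀ t : I → T, (∀ i, t i ∈ Tp ∪ Tm) → |φ t - a - ∑ i, b i (t i)| ≤ τ) →
      (∀ i u u', u ∈ Tp ∪ Tm → u' ∈ Tp ∪ Tm → b i u ≤ b i u' + B) →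
      (∀ i, ε * ∫ u in Tp ∪ Tm, Real.exp (b i u) ∂ν ≤ ∫ u in Tp, Real.exp (b i u) ∂ν ∧
        ∫ u in Tp, Real.exp (b i u) ∂ν ≤ (1 - ε) * ∫ u in Tp ∪ Tm, Real.exp (b i u) ∂ν) →
      ∀ {X : (I → T) → ℤ}, Measurable X → ∀ (S' : Finset I),
      (∀ t : I → T, (∀ i, t i ∈ Tp ∪ Tm) → ∀ i ∈ S', ∀ u ∈ Tp, t i ∈ Tm →
        X t + 1 ≤ X (Function.update t i u)) →
      ∀ (j : ℤ),
      ∫⁻ t, (Set.pi Set.univ fun _ : I => Tp ∪ Tm).indicator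
          (fun t => if X t = j then ENNReal.ofReal (Real.exp (φ t)) else 0) t
          ∂Measure.pi (fun _ : I => ν) ≤
        ENNReal.ofReal (Real.exp (2 * τ) * C / Real.sqrt (S'.card + 1)) *
          ∫⁻ t, (Set.pi Set.univ fun _ : I => Tp ∪ Tm).indicator
            (fun t => ENNReal.ofReal (Real.exp (φ t))) t ∂Measure.pi (fun _ : I => ν)) →
    (∀ (Nf n R N m : ℕ) [NeZero n], 2 * R + 1 < n → ∀ (cs : Fin N → (Fin 4 → ℤ)),
      (∀ i j, i ≠ j → ∀ q : Fin 4 → ℤ, ∃ k : Fin 4, ((2 * R + 2 : ℕ) : ℤ) ≤ |cs i k - cs j k - q k * n|) →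
      ∀ (β : ℝ) (μ : Fin Nf → ℝ), (∀ f, 0 < μ f) →
      ∀ (T : Set ((↥(box 4 R) × Fin 4) → SU3)), MeasurableSet T →
      ∀ (Λ q : ℝ), 1 ≤ Λ → 0 < q →
        q ≤ ((Measure.pi fun _ : ↥(box 4 R) × Fin 4 => haarProbability SU3) T).toReal →
        (∀ (i : Fin N) (U U' : GaugeConfig 4 n SU3),
          (∀ e, (¬ ∃ y : ↥(box 4 R), Torus.proj n (cs i + (y : Fin 4 → ℤ)) = e.1) → U' e = U e) →
          Real.exp (-β * wilsonAction (fundamentalRep (Fin 3)) U') *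
              ∏ f, ‖fermionDet (wilsonDirac (fundamentalRep (Fin 3)) U' (μ f) 1)‖ ≤
            Λ * (Real.exp (-β * wilsonAction (fundamentalRep (Fin 3)) U) *
              ∏ f, ‖fermionDet (wilsonDirac (fundamentalRep (Fin 3)) U (μ f) 1)‖)) →
        qcdLatticeMeasure n β μ
            {U | (Finset.univ.filter fun i : Fin N =>
                (fun yi : ↥(box 4 R) × Fin 4 => U (Torus.proj n (cs i + (yi.1 : Fin 4 → ℤ)), yi.2)) ∈ T).card
              < m} ≤
          ENNReal.ofReal ((N.choose (N - (m - 1)) : ℝ) * (1 - q / Λ ^ 2) ^ (N - (m - 1)))) →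
    (∀ ε : ℝ, 0 < ε → ∃ C : ℝ, ∀ (N : ℕ) (p : Fin N → ℝ), (∀ i, ε ≤ p i ∧ p i ≤ 1 - ε) →
      ∀ 𝒜 : Finset (Fin N → Bool), (∀ s ∈ 𝒜, ∀ s' ∈ 𝒜, (∀ i, s i ≤ s' i) → s = s') →
        ∑ s ∈ 𝒜, ∏ i, (if s i then p i else 1 - p i) ≤ C / Real.sqrt (N + 1)) →
    ∀ {Nf R : ℕ} {Tp Tm : Set ((↥(box 4 R) × Fin 4) → SU3)}, MeasurableSet Tp → MeasurableSet Tm →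
    (Measure.pi fun _ : ↥(box 4 R) × Fin 4 => haarProbability SU3) Tp ≠ 0 →
    (Measure.pi fun _ : ↥(box 4 R) × Fin 4 => haarProbability SU3) Tm ≠ 0 →
    ∀ {β lo hi A B C₃ κ : ℝ}, 0 ≤ β → 0 < lo → lo ≤ hi → 0 < κ →
    (∀ (n : ℕ) [NeZero n], 2 * R + 1 < n → ∀ (c : Fin 4 → ℤ) (μ : Fin Nf → ℝ),
      (∀ f, lo ≤ μ f ∧ μ f ≤ hi) → ∀ (U U' : GaugeConfig 4 n SU3),
        (∀ e, (¬ ∃ y : ↥(box 4 R), Torus.proj n (c + (y : Fin 4 → ℤ)) = e.1) → U' e = U e) →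
        |wilsonAction (fundamentalRep (Fin 3)) U' - wilsonAction (fundamentalRep (Fin 3)) U| ≤ A ∧
          |Real.log (∏ f : Fin Nf, ‖fermionDet (wilsonDirac (fundamentalRep (Fin 3)) U' (μ f) 1)‖) -
              Real.log (∏ f : Fin Nf, ‖fermionDet (wilsonDirac (fundamentalRep (Fin 3)) U (μ f) 1)‖)| ≤ B) →
    (∀ (n : ℕ) [NeZero n] (c₁ c₂ : Fin 4 → ℤ) (s : ℕ),
      (∀ q : Fin 4 → ℤ, ∃ j : Fin 4, ((2 * R + 1 + s : ℕ) : ℤ) ≤ |c₁ j - c₂ j - q j * n|) →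
      ∀ (μ : Fin Nf → ℝ), (∀ f, lo ≤ μ f ∧ μ f ≤ hi) →
        ∀ (U U₁ U₂ U₁₂ : GaugeConfig 4 n SU3),
          (∀ e, (¬ ∃ y : ↥(box 4 R), Torus.proj n (c₁ + (y : Fin 4 → ℤ)) = e.1) → U₁ e = U e) →
          (∀ e, (¬ ∃ y : ↥(box 4 R), Torus.proj n (c₂ + (y : Fin 4 → ℤ)) = e.1) → U₂ e = U e) →
          (∀ e, (∃ y : ↥(box 4 R), Torus.proj n (c₁ + (y : Fin 4 → ℤ)) = e.1) → U₁₂ e = U₁ e) →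
          (∀ e, (¬ ∃ y : ↥(box 4 R), Torus.proj n (c₁ + (y : Fin 4 → ℤ)) = e.1) → U₁₂ e = U₂ e) →
          |Real.log (∏ f : Fin Nf, ‖fermionDet (wilsonDirac (fundamentalRep (Fin 3)) U₁₂ (μ f) 1)‖) -
              Real.log (∏ f : Fin Nf, ‖fermionDet (wilsonDirac (fundamentalRep (Fin 3)) U₁ (μ f) 1)‖) -
              Real.log (∏ f : Fin Nf, ‖fermionDet (wilsonDirac (fundamentalRep (Fin 3)) U₂ (μ f) 1)‖) +
              Real.log (∏ f : Fin Nf, ‖fermionDet (wilsonDirac (fundamentalRep (Fin 3)) U (μ f) 1)‖)| ≤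
            C₃ * Real.exp (-(κ * s))) →
    ∀ L₀ : ℕ, ∃ L' : ℕ, L₀ ≤ L' ∧ 2 * R + 1 < 2 * L' + 1 ∧
      ∀ (μ : Fin Nf → ℝ), (∀ f, lo ≤ μ f ∧ μ f ≤ hi) →
      ∀ {X : GaugeConfig 4 (2 * L' + 1) SU3 → ℤ}, Measurable X →
      (∀ (c : Fin 4 → ℤ) (U U' : GaugeConfig 4 (2 * L' + 1) SU3),
        (∀ e, (¬ ∃ y : ↥(box 4 R), Torus.proj (2 * L' + 1) (c + (y : Fin 4 → ℤ)) = e.1) → U' e = U e) →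
        (fun yi : ↥(box 4 R) × Fin 4 => U (Torus.proj (2 * L' + 1) (c + (yi.1 : Fin 4 → ℤ)), yi.2)) ∈ Tm →
        (fun yi : ↥(box 4 R) × Fin 4 => U' (Torus.proj (2 * L' + 1) (c + (yi.1 : Fin 4 → ℤ)), yi.2)) ∈ Tp →
        X U + 1 ≤ X U') →
      ∀ j : ℤ, qcdLatticeMeasure (2 * L' + 1) β μ {U | X U = j} ≤ 4⁻¹ := by
  intro hFAM hACA hAW Nf R Tp Tm hTp hTm hTp0 hTm0 β lo hi A B C₃ κ hβ hlo hlohi hκ hAB hQL L₀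
  -- the Haar measures of the classes
  set ν : Measure ((↥(box 4 R) × Fin 4) → SU3) :=
    Measure.pi fun _ : ↥(box 4 R) × Fin 4 => haarProbability SU3 with hν
  have hmp : 0 < (ν Tp).toReal := ENNReal.toReal_pos hTp0 (measure_ne_top ν Tp)
  have hmm : 0 < (ν Tm).toReal := ENNReal.toReal_pos hTm0 (measure_ne_top ν Tm)
  -- `A, B ≥ 0` (compare a field with itself on the torus of side `2R+2`)
  have hAB0 : 0 ≤ A ∧ 0 ≤ B := by
    have h := hAB (2 * R + 1 + 1) (by omega) 0 (fun _ => lo) (fun _ => ⟨le_rfl, hlohi⟩)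
      (fun _ => 1) (fun _ => 1) (fun _ _ => rfl)
    simp only [sub_self, abs_zero] at h
    exact h
  -- the one-box cost factor and the odds floor
  set B' : ℝ := β * A + B with hB'
  have hB'0 : 0 ≤ B' := add_nonneg (mul_nonneg hβ hAB0.1) hAB0.2
  set Λ : ℝ := Real.exp B' with hΛ
  have hΛ1 : 1 ≤ Λ := Real.one_le_exp hB'0
  set q : ℝ := (ν (Tp ∪ Tm)).toReal with hq
  have hqpos : 0 < q := by
    have h1 : (ν Tp).toReal ≤ q := ENNReal.toReal_mono (measure_ne_top ν _) (measure_mono subset_union_left)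
    linarith
  have hq1 : q ≤ 1 := by
    have := ENNReal.toReal_mono ENNReal.one_ne_top (prob_le_one (μ := ν) (s := Tp ∪ Tm))
    simpa using this
  set p : ℝ := q / Λ ^ 2 with hp
  have hppos : 0 < p := by positivity
  have hp1 : p ≤ 1 := by
    rw [hp, div_le_one (by positivity)]
    nlinarith
  set ε₀ : ℝ := Real.exp (-2 * B') * min (ν Tp).toReal (ν Tm).toReal with hε₀
  have hε₀pos : 0 < ε₀ := mul_pos (Real.exp_pos _) (lt_min hmp hmm)
  obtain ⟨C, hC⟩ := hAW ε₀ hε₀pos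
  have hC1 : 1 ≤ C := spreadR3_antichain_const_ge_one hC
  -- the counting constants
  obtain ⟨m, hm⟩ := spreadR3_exists_m C
  obtain ⟨N, hmN, hN⟩ := spreadR3_exists_N m hppos hp1
  obtain ⟨D, hD1, hD⟩ := spreadR3_exists_D hκ ((N : ℝ) ^ 2 * |C₃|)
  set γ : ℝ := |C₃| * Real.exp (-(κ * D)) with hγ
  have hγ0 : 0 ≤ γ := by positivity
  -- the torus
  set s : ℕ := 2 * R + 1 + D with hs
  have hs1 : 1 ≤ s := by omega
  set L' : ℕ := max L₀ (N * s + R + 1) with hL'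
  have hRn : 2 * R + 1 < 2 * L' + 1 := by
    have : R + 1 ≤ L' := le_trans (by omega) (le_max_right _ _)
    omega
  have hNs : N * s ≤ 2 * L' + 1 := by
    have : N * s ≤ L' := le_trans (by omega) (le_max_right _ _)
    omega
  refine ⟨L', le_max_left _ _, hRn, ?_⟩
  set n : ℕ := 2 * L' + 1 with hn
  intro μ hμ X hXm hmonoX j
  have hμpos : ∀ f, 0 < μ f := fun f => hlo.trans_le (hμ f).1
  -- the centres
  set cs : Fin N → (Fin 4 → ℤ) := fun i k => if k = 0 then ((i : ℕ) : ℤ) * s else 0 with hcs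
  have hsep : ∀ i j, i ≠ j → ∀ q : Fin 4 → ℤ, ∃ k : Fin 4,
      ((2 * R + 1 + D : ℕ) : ℤ) ≤ |cs i k - cs j k - q k * n| :=
    spreadR3_centres_separated s N n hs1 hNs
  have hsep2 : ∀ i j, i ≠ j → ∀ q : Fin 4 → ℤ, ∃ k : Fin 4,
      ((2 * R + 2 : ℕ) : ℤ) ≤ |cs i k - cs j k - q k * n| := fun i j hij q' => by
    obtain ⟨k, hk⟩ := hsep i j hij q'
    refine ⟨k, le_trans ?_ hk⟩
    push_cast
    have : (1 : ℤ) ≤ D := by exact_mod_cast hD1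
    linarith
  -- disjointness of the classes (a field whose box content lies in both would contradict monotonicity)
  have hdisj : Disjoint Tp Tm := by
    rw [Set.disjoint_left]
    intro t htp htm
    obtain ⟨U, hU⟩ := spreadR3_exists_config_with_content hRn.le 0 t
    have := hmonoX 0 U U (fun _ _ => rfl) (by rw [hU]; exact htm) (by rw [hU]; exact htp)
    linarith
  -- positivity of the weights and the one-box / two-box bounds on the log-density
  set w : GaugeConfig 4 n SU3 → ℝ := fun U =>
    ∏ f, ‖fermionDet (wilsonDirac (fundamentalRep (Fin 3)) U (μ f) 1)‖ with hw
  have hwpos : ∀ U, 0 < w U := fun U => spreadR3_pqWeight_pos hμpos U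
  have hone : ∀ (c : Fin 4 → ℤ) (U U' : GaugeConfig 4 n SU3),
      (∀ e, (¬ ∃ y : ↥(box 4 R), Torus.proj n (c + (y : Fin 4 → ℤ)) = e.1) → U' e = U e) →
      -β * wilsonAction (fundamentalRep (Fin 3)) U' + Real.log (w U') ≤
        -β * wilsonAction (fundamentalRep (Fin 3)) U + Real.log (w U) + B' := by
    intro c U U' hagree
    obtain ⟨hS, hlw⟩ := hAB n hRn c μ hμ U U' hagree
    have h1 : -β * wilsonAction (fundamentalRep (Fin 3)) U' ≤
        -β * wilsonAction (fundamentalRep (Fin 3)) U + β * A := by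
      have := (abs_le.1 hS).1
      nlinarith
    have h2 : Real.log (w U') ≤ Real.log (w U) + B := by
      have := (abs_le.1 hlw).2
      simp only [hw]
      linarith
    simp only [hB']
    linarith
  have hosc : ∀ (i : Fin N) (U U' : GaugeConfig 4 n SU3),
      (∀ e, (¬ ∃ y : ↥(box 4 R), Torus.proj n (cs i + (y : Fin 4 → ℤ)) = e.1) → U' e = U e) →
      -β * wilsonAction (fundamentalRep (Fin 3)) U' +
          Real.log (∏ f, ‖fermionDet (wilsonDirac (fundamentalRep (Fin 3)) U' (μ f) 1)‖) ≤
        -β * wilsonAction (fundamentalRep (Fin 3)) U +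
          Real.log (∏ f, ‖fermionDet (wilsonDirac (fundamentalRep (Fin 3)) U (μ f) 1)‖) + B' :=
    fun i U U' hagree => hone (cs i) U U' hagree
  have hcost : ∀ (i : Fin N) (U U' : GaugeConfig 4 n SU3),
      (∀ e, (¬ ∃ y : ↥(box 4 R), Torus.proj n (cs i + (y : Fin 4 → ℤ)) = e.1) → U' e = U e) →
      Real.exp (-β * wilsonAction (fundamentalRep (Fin 3)) U') *
          ∏ f, ‖fermionDet (wilsonDirac (fundamentalRep (Fin 3)) U' (μ f) 1)‖ ≤
        Λ * (Real.exp (-β * wilsonAction (fundamentalRep (Fin 3)) U) *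
          ∏ f, ‖fermionDet (wilsonDirac (fundamentalRep (Fin 3)) U (μ f) 1)‖) := by
    intro i U U' hagree
    have h := hone (cs i) U U' hagree
    have hexp : ∀ V : GaugeConfig 4 n SU3, Real.exp (-β * wilsonAction (fundamentalRep (Fin 3)) V) * w V =
        Real.exp (-β * wilsonAction (fundamentalRep (Fin 3)) V + Real.log (w V)) := fun V => by
      rw [Real.exp_add, Real.exp_log (hwpos V)]
    change Real.exp (-β * wilsonAction (fundamentalRep (Fin 3)) U') * w U' ≤
      Λ * (Real.exp (-β * wilsonAction (fundamentalRep (Fin 3)) U) * w U)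
    rw [hexp, hexp, hΛ, ← Real.exp_add]
    exact Real.exp_le_exp.2 (by linarith)
  have hmix : ∀ (i j : Fin N), i ≠ j → ∀ (U U₁ U₂ U₁₂ : GaugeConfig 4 n SU3),
      (∀ e, (¬ ∃ y : ↥(box 4 R), Torus.proj n (cs i + (y : Fin 4 → ℤ)) = e.1) → U₁ e = U e) →
      (∀ e, (¬ ∃ y : ↥(box 4 R), Torus.proj n (cs j + (y : Fin 4 → ℤ)) = e.1) → U₂ e = U e) →
      (∀ e, (∃ y : ↥(box 4 R), Torus.proj n (cs i + (y : Fin 4 → ℤ)) = e.1) → U₁₂ e = U₁ e) →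
      (∀ e, (¬ ∃ y : ↥(box 4 R), Torus.proj n (cs i + (y : Fin 4 → ℤ)) = e.1) → U₁₂ e = U₂ e) →
      |(-β * wilsonAction (fundamentalRep (Fin 3)) U₁₂ +
          Real.log (∏ f, ‖fermionDet (wilsonDirac (fundamentalRep (Fin 3)) U₁₂ (μ f) 1)‖)) -
        (-β * wilsonAction (fundamentalRep (Fin 3)) U₁ +
          Real.log (∏ f, ‖fermionDet (wilsonDirac (fundamentalRep (Fin 3)) U₁ (μ f) 1)‖)) -
        (-β * wilsonAction (fundamentalRep (Fin 3)) U₂ +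
          Real.log (∏ f, ‖fermionDet (wilsonDirac (fundamentalRep (Fin 3)) U₂ (μ f) 1)‖)) +
        (-β * wilsonAction (fundamentalRep (Fin 3)) U +
          Real.log (∏ f, ‖fermionDet (wilsonDirac (fundamentalRep (Fin 3)) U (μ f) 1)‖))| ≤ γ := by
    intro i j hij U U₁ U₂ U₁₂ h1 h2 h3 h4
    have hS := spread_wilsonAction_mixed_eq_zero (fundamentalRep (Fin 3)) hD1 (hsep i j hij) U U₁ U₂ U₁₂
      h1 h2 h3 h4
    have hW := hQL n (cs i) (cs j) D (hsep i j hij) μ hμ U U₁ U₂ U₁₂ h1 h2 h3 h4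
    have hC₃ : C₃ * Real.exp (-(κ * D)) ≤ γ :=
      mul_le_mul_of_nonneg_right (le_abs_self _) (Real.exp_pos _).le
    have heq : (-β * wilsonAction (fundamentalRep (Fin 3)) U₁₂ +
          Real.log (∏ f, ‖fermionDet (wilsonDirac (fundamentalRep (Fin 3)) U₁₂ (μ f) 1)‖)) -
        (-β * wilsonAction (fundamentalRep (Fin 3)) U₁ +
          Real.log (∏ f, ‖fermionDet (wilsonDirac (fundamentalRep (Fin 3)) U₁ (μ f) 1)‖)) -
        (-β * wilsonAction (fundamentalRep (Fin 3)) U₂ +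
          Real.log (∏ f, ‖fermionDet (wilsonDirac (fundamentalRep (Fin 3)) U₂ (μ f) 1)‖)) +
        (-β * wilsonAction (fundamentalRep (Fin 3)) U +
          Real.log (∏ f, ‖fermionDet (wilsonDirac (fundamentalRep (Fin 3)) U (μ f) 1)‖)) =
        -β * (wilsonAction (fundamentalRep (Fin 3)) U₁₂ - wilsonAction (fundamentalRep (Fin 3)) U₁ -
          wilsonAction (fundamentalRep (Fin 3)) U₂ + wilsonAction (fundamentalRep (Fin 3)) U) +
        (Real.log (∏ f, ‖fermionDet (wilsonDirac (fundamentalRep (Fin 3)) U₁₂ (μ f) 1)‖) -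
          Real.log (∏ f, ‖fermionDet (wilsonDirac (fundamentalRep (Fin 3)) U₁ (μ f) 1)‖) -
          Real.log (∏ f, ‖fermionDet (wilsonDirac (fundamentalRep (Fin 3)) U₂ (μ f) 1)‖) +
          Real.log (∏ f, ‖fermionDet (wilsonDirac (fundamentalRep (Fin 3)) U (μ f) 1)‖)) := by ring
    rw [heq, hS, mul_zero, zero_add]
    exact hW.trans hC₃
  -- the uniform fibre factor
  have hη : Real.exp (2 * ((N : ℝ) ^ 2 * γ)) * C / Real.sqrt (m + 1) ≤ 1 / 8 := by
    have hτ : (N : ℝ) ^ 2 * γ ≤ Real.log 2 / 2 := by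
      have : (N : ℝ) ^ 2 * γ = (N : ℝ) ^ 2 * |C₃| * Real.exp (-(κ * D)) := by rw [hγ]; ring
      rw [this]; exact hD
    have h2 := spreadR3_exp_two_mul_le_two hτ
    have hC0 : 0 ≤ C := zero_le_one.trans hC1
    calc Real.exp (2 * ((N : ℝ) ^ 2 * γ)) * C / Real.sqrt (m + 1)
        ≤ 2 * C / Real.sqrt (m + 1) :=
          div_le_div_of_nonneg_right (mul_le_mul_of_nonneg_right h2 hC0) (Real.sqrt_nonneg _)
      _ ≤ 1 / 8 := hm m le_rfl
  -- few active cores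
  have hfew : qcdLatticeMeasure n β μ
      {U | (Finset.univ.filter fun i : Fin N =>
        (fun yi : ↥(box 4 R) × Fin 4 => U (Torus.proj n (cs i + (yi.1 : Fin 4 → ℤ)), yi.2)) ∈
          Tp ∪ Tm).card < m} ≤ ENNReal.ofReal (1 / 8) := by
    have h := hACA Nf n R N m hRn cs hsep2 β μ hμpos (Tp ∪ Tm) (hTp.union hTm) Λ q hΛ1 hqpos le_rfl hcost
    have h' := h.trans (ENNReal.ofReal_le_ofReal hN)
    convert h' using 4 <;> first | rfl | exact Iff.rfl | simp only [Finset.filter_congr_decidable] | congr!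
  -- monotonicity at the cores
  have hmono : ∀ (i : Fin N) (U U' : GaugeConfig 4 n SU3),
      (∀ e, (¬ ∃ y : ↥(box 4 R), Torus.proj n (cs i + (y : Fin 4 → ℤ)) = e.1) → U' e = U e) →
      (fun yi : ↥(box 4 R) × Fin 4 => U (Torus.proj n (cs i + (yi.1 : Fin 4 → ℤ)), yi.2)) ∈ Tm →
      (fun yi : ↥(box 4 R) × Fin 4 => U' (Torus.proj n (cs i + (yi.1 : Fin 4 → ℤ)), yi.2)) ∈ Tp →
      X U + 1 ≤ X U' := fun i U U' => hmonoX (cs i) U U'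
  exact spreadR3_atom_le_quarter hFAM hRn.le cs hsep hTp hTm hdisj hTp0 hC β μ hμpos hγ0 (le_of_eq hε₀)
    hosc hmix hη hfew hXm hmono j

end Summit.QuantumFields.QCD.Cruxes.WindowExtinction.FreeVolumeHeavyWitness

end
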